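import Summits.NavierStokesRegularity.NavierStokesRegularity.Theorems.EulerZoomLiouvillePowerGaugeEulerLiouvilleNeedleBandLaw
import Summits.NavierStokesRegularity.NavierStokesRegularity.Theorems.EulerZoomLiouvillePowerGaugeEulerLiouvilleNeedleSphereSlices
import Literature.Analysis.FluidPDE.TaoLocalisedEnstrophy

/-!
# The fast set of a general C¹ profile on one sphere chart is super-exponentially small
# (plate t39c-B of ROUND-38 «the waiting-time exponent»; crux E `PowerGaugeEulerLiouville`,
# stmt-NavierStokesRegularity-19832)

LANDING PLATE prepared by nsreg-p2 g33 (TEXT custody, DIRECTOR-NS #199 (1)) for a keyed PROVER hand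
(`--supports stmt-NavierStokesRegularity-19832 --as helper`).  No Euler content, NO SYMMETRY.

On the orthographic chart `Φ_t = sphereChart e e₁ e₂ t` of the sphere `‖y‖ = t` the radial-flux observable
`F_t(z) = −⟪Φ_t z, V(Φ_t z)⟫` is `C¹` on the open chart disc with `‖F_t'‖² ≤ (100/19)(2‖V‖² + 2t²‖DV‖²) ∘ Φ_t` on
`‖z‖ ≤ 9t/10` (`NeedleSphereChart.norm_sphereFluxDeriv_sq_le`).  Feeding the chart energies
`𝒜 ≥ ∫_{‖z‖<9t/10} ‖V∘Φ_t‖²`, `ℰ ≥ ∫_{‖z‖<9t/10} ‖DV∘Φ_t‖²` into the BAND LAW (`NeedleBandLaw.band_decay`, levels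
`γt²/2 → γt²`, radii `9t/10 → 17t/20`) gives

* `chart_fastArea_le`: `|{‖z‖ < 17t/20 : F_t(z) > γt²}| ≤ (4𝒜/(γ²t²))·e^{−J/4}` for every `J ≥ 1` with
  `bandConst·J²·(4𝒜/(γ²t²)) ≤ (t/20)²/8` and `8·bandConst·J·(200/19)(𝒜 + t²ℰ) ≤ (γt²/2)²`.
[folklore: Chebyshev + chain rule; the band law is plate t39b]
-/

set_option linter.dupNamespace false

open MeasureTheory Set Metric Real
open scoped RealInnerProductSpace ENNReal

namespace Summit.NavierStokesRegularity.NavierStokesRegularity.Theorems.PowerGaugeEulerLiouville.NeedleChartFastArea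

open NeedleDiscChart NeedleSphereChart NeedleThinness NeedleBandTest NeedleBandLaw

variable {e e₁ e₂ : (EuclideanSpace ℝ (Fin 3))} {V : (EuclideanSpace ℝ (Fin 3)) → (EuclideanSpace ℝ (Fin 3))}

/-- The chart flux observable `F_t(z) = −⟪Φ_t z, V (Φ_t z)⟫` (positive where the flow points INTO the sphere). -/
noncomputable def chartFlux (e e₁ e₂ : (EuclideanSpace ℝ (Fin 3))) (V : (EuclideanSpace ℝ (Fin 3)) → (EuclideanSpace ℝ (Fin 3)))
    (t : ℝ) (z : ℂ) : ℝ :=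
  -⟪sphereChart e e₁ e₂ t z, V (sphereChart e e₁ e₂ t z)⟫

/-- Its derivative on the open chart disc. -/
noncomputable def chartFluxDeriv (e e₁ e₂ : (EuclideanSpace ℝ (Fin 3)))
    (V : (EuclideanSpace ℝ (Fin 3)) → (EuclideanSpace ℝ (Fin 3))) (t : ℝ) (z : ℂ) : ℂ →L[ℝ] ℝ :=
  -sphereFluxDeriv e e₁ e₂ t z (V (sphereChart e e₁ e₂ t z)) (fderiv ℝ V (sphereChart e e₁ e₂ t z))

/-- `F_t` is continuous for continuous `V`. [folklore] -/
theorem continuous_chartFlux (hVc : Continuous V) (t : ℝ) : Continuous (chartFlux e e₁ e₂ V t) := by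
  have hφ := continuous_sphereChart e e₁ e₂ t
  exact (hφ.inner (hVc.comp hφ)).neg

/-- `F_t` is differentiable on the open chart disc with derivative `chartFluxDeriv`. [folklore: product rule] -/
theorem hasFDerivAt_chartFlux (hV : ContDiff ℝ 1 V) {t : ℝ} {z : ℂ} (hz : ‖z‖ < t) :
    HasFDerivAt (chartFlux e e₁ e₂ V t) (chartFluxDeriv e e₁ e₂ V t z) z := by
  have hd : HasFDerivAt V (fderiv ℝ V (sphereChart e e₁ e₂ t z)) (sphereChart e e₁ e₂ t z) :=
    ((hV.differentiable one_ne_zero) _).hasFDerivAt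
  exact (hasFDerivAt_sphereFlux e e₁ e₂ hz hd).neg

/-- `chartFluxDeriv` is continuous on the open chart disc. [folklore] -/
theorem continuousOn_chartFluxDeriv (hV : ContDiff ℝ 1 V) (t : ℝ) :
    ContinuousOn (chartFluxDeriv e e₁ e₂ V t) (ball (0 : ℂ) t) :=
  (continuousOn_sphereFluxDeriv hV.continuous (hV.continuous_fderiv one_ne_zero) e e₁ e₂ t).neg

-- `‖x‖ₑ² = ofReal ‖x‖²` is the tree's `Literature.Analysis.FluidPDE.enorm_sq_eq_ofReal_norm_sq` (…TaoLocalisedEnstrophy); the plate's copy was removed at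
-- the gate (dedup.landed) by the firing seat.

/-- POINTWISE DERIVATIVE BOUND on `‖z‖ ≤ θt`, `θ < 1`:
`‖F_t'(z)‖ₑ² ≤ (2/(1−θ²))‖V(Φ_t z)‖ₑ² + (2t²/(1−θ²))‖DV(Φ_t z)‖ₑ²`. [folklore: chain rule, `t/h ≤ 1/√(1−θ²)`] -/
theorem enorm_chartFluxDeriv_sq_le (hon : Orthonormal ℝ ![e, e₁, e₂]) {t θ : ℝ} (ht : 0 < t) (hθ0 : 0 ≤ θ) (hθ1 : θ < 1)
    {z : ℂ} (hz : ‖z‖ ≤ θ * t) :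
    ‖chartFluxDeriv e e₁ e₂ V t z‖ₑ ^ 2 ≤
      ENNReal.ofReal (2 / (1 - θ ^ 2)) * ‖V (sphereChart e e₁ e₂ t z)‖ₑ ^ 2 +
        ENNReal.ofReal (2 * t ^ 2 / (1 - θ ^ 2)) * ‖fderiv ℝ V (sphereChart e e₁ e₂ t z)‖ₑ ^ 2 := by
  have he : ‖e‖ = 1 := norm_frame₀ hon
  have h₁ : ‖e₁‖ = 1 := norm_frame₁ hon
  have h₂ : ‖e₂‖ = 1 := norm_frame₂ hon
  have he1 : ⟪e, e₁⟫ = 0 := inner_frame₀₁ hon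
  have he2 : ⟪e, e₂⟫ = 0 := inner_frame₀₂ hon
  have h12 : ⟪e₁, e₂⟫ = 0 := inner_frame₁₂ hon
  have hθ2 : 0 < 1 - θ ^ 2 := by nlinarith
  have hzt : ‖z‖ < t := lt_of_le_of_lt hz (by nlinarith)
  set Vy := V (sphereChart e e₁ e₂ t z) with hVy
  set V' := fderiv ℝ V (sphereChart e e₁ e₂ t z) with hV'
  have hsq := norm_sphereFluxDeriv_sq_le he h₁ h₂ he1 he2 h12 hzt Vy V'
  -- `(t/h)² ≤ 1/(1−θ²)`
  have hh2 : t ^ 2 * (1 - θ ^ 2) ≤ capHeight t z ^ 2 := by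
    rw [capHeight_sq hzt.le]
    have : ‖z‖ ^ 2 ≤ (θ * t) ^ 2 := pow_le_pow_left₀ (norm_nonneg _) hz 2
    nlinarith
  have hhpos : 0 < capHeight t z := capHeight_pos hzt
  have hq : (t / capHeight t z) ^ 2 ≤ 1 / (1 - θ ^ 2) := by
    rw [div_pow, div_le_div_iff₀ (pow_pos hhpos 2) hθ2, one_mul]
    linarith
  have hreal : ‖chartFluxDeriv e e₁ e₂ V t z‖ ^ 2 ≤
      2 / (1 - θ ^ 2) * ‖Vy‖ ^ 2 + 2 * t ^ 2 / (1 - θ ^ 2) * ‖V'‖ ^ 2 := by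
    rw [chartFluxDeriv, norm_neg]
    have h0 : 0 ≤ 2 * ‖Vy‖ ^ 2 + 2 * (t * ‖V'‖) ^ 2 := by positivity
    calc ‖sphereFluxDeriv e e₁ e₂ t z Vy V'‖ ^ 2 ≤ (t / capHeight t z) ^ 2 * (2 * ‖Vy‖ ^ 2 + 2 * (t * ‖V'‖) ^ 2) := hsq
      _ ≤ 1 / (1 - θ ^ 2) * (2 * ‖Vy‖ ^ 2 + 2 * (t * ‖V'‖) ^ 2) := mul_le_mul_of_nonneg_right hq h0
      _ = 2 / (1 - θ ^ 2) * ‖Vy‖ ^ 2 + 2 * t ^ 2 / (1 - θ ^ 2) * ‖V'‖ ^ 2 := by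
          field_simp
  rw [Literature.Analysis.FluidPDE.enorm_sq_eq_ofReal_norm_sq, Literature.Analysis.FluidPDE.enorm_sq_eq_ofReal_norm_sq, Literature.Analysis.FluidPDE.enorm_sq_eq_ofReal_norm_sq, ← ENNReal.ofReal_mul (by positivity),
    ← ENNReal.ofReal_mul (by positivity), ← ENNReal.ofReal_add (by positivity) (by positivity)]
  exact ENNReal.ofReal_le_ofReal hreal

/-- CHEBYSHEV for the half level: `|{‖z‖ < θt : F_t(z) > γt²/2}| ≤ (4/(γ²t²)) ∫_{‖z‖<θt} ‖V∘Φ_t‖²`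
(`F_t(z) ≤ t‖V(Φ_t z)‖` on the chart disc). [folklore] -/
theorem volume_levSet_half_le (hon : Orthonormal ℝ ![e, e₁, e₂]) (hVc : Continuous V) {t θ γ : ℝ} (ht : 0 < t)
    (hθ1 : θ ≤ 1) (hγ : 0 < γ) :
    volume (levSet (chartFlux e e₁ e₂ V t) (θ * t) (γ * t ^ 2 / 2)) ≤
      ENNReal.ofReal (4 / (γ ^ 2 * t ^ 2)) *
        ∫⁻ z in ball (0 : ℂ) (θ * t), ‖V (sphereChart e e₁ e₂ t z)‖ₑ ^ 2 := by
  have he : ‖e‖ = 1 := norm_frame₀ hon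
  have h₁ : ‖e₁‖ = 1 := norm_frame₁ hon
  have h₂ : ‖e₂‖ = 1 := norm_frame₂ hon
  have he1 : ⟪e, e₁⟫ = 0 := inner_frame₀₁ hon
  have he2 : ⟪e, e₂⟫ = 0 := inner_frame₀₂ hon
  have h12 : ⟪e₁, e₂⟫ = 0 := inner_frame₁₂ hon
  set ε : ℝ≥0∞ := ENNReal.ofReal ((γ * t / 2) ^ 2) with hεdef
  have hεpos : 0 < (γ * t / 2) ^ 2 := by positivity
  have hε0 : ε ≠ 0 := (ENNReal.ofReal_pos.2 hεpos).ne'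
  have hεtop : ε ≠ ⊤ := ENNReal.ofReal_ne_top
  set f : ℂ → ℝ≥0∞ := fun z => ‖V (sphereChart e e₁ e₂ t z)‖ₑ ^ 2 with hfdef
  have hfm : Measurable f := ((hVc.comp (continuous_sphereChart e e₁ e₂ t)).measurable.enorm).pow_const 2
  -- the level set lies in the Chebyshev set
  have hsub : levSet (chartFlux e e₁ e₂ V t) (θ * t) (γ * t ^ 2 / 2) ⊆ ball (0 : ℂ) (θ * t) ∩ {z | ε ≤ f z} := by
    intro z hz
    rw [mem_levSet] at hz
    obtain ⟨hzr, hF⟩ := hz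
    have hzt : ‖z‖ ≤ t := by nlinarith [norm_nonneg z]
    refine ⟨mem_ball_zero_iff.2 hzr, ?_⟩
    show ε ≤ f z
    rw [hfdef]
    simp only
    rw [Literature.Analysis.FluidPDE.enorm_sq_eq_ofReal_norm_sq]
    refine ENNReal.ofReal_le_ofReal ?_
    have hcs : chartFlux e e₁ e₂ V t z ≤ t * ‖V (sphereChart e e₁ e₂ t z)‖ := by
      rw [chartFlux]
      calc -⟪sphereChart e e₁ e₂ t z, V (sphereChart e e₁ e₂ t z)⟫
          ≤ |⟪sphereChart e e₁ e₂ t z, V (sphereChart e e₁ e₂ t z)⟫| := neg_le_abs _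
        _ ≤ ‖sphereChart e e₁ e₂ t z‖ * ‖V (sphereChart e e₁ e₂ t z)‖ := abs_real_inner_le_norm _ _
        _ = t * ‖V (sphereChart e e₁ e₂ t z)‖ := by rw [norm_sphereChart he h₁ h₂ he1 he2 h12 ht.le hzt]
    have hVge : γ * t / 2 ≤ ‖V (sphereChart e e₁ e₂ t z)‖ := by
      by_contra hcon
      rw [not_le] at hcon
      have : t * ‖V (sphereChart e e₁ e₂ t z)‖ < t * (γ * t / 2) := mul_lt_mul_of_pos_left hcon ht
      linarith
    exact pow_le_pow_left₀ (by positivity) hVge 2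
  have hmarkov := mul_meas_ge_le_lintegral₀ (μ := volume.restrict (ball (0 : ℂ) (θ * t))) hfm.aemeasurable ε
  rw [Measure.restrict_apply' measurableSet_ball, inter_comm] at hmarkov
  have hinv : ε⁻¹ = ENNReal.ofReal (4 / (γ ^ 2 * t ^ 2)) := by
    rw [hεdef, ← ENNReal.ofReal_inv_of_pos hεpos]
    congr 1
    field_simp
    ring
  calc volume (levSet (chartFlux e e₁ e₂ V t) (θ * t) (γ * t ^ 2 / 2))
      ≤ volume (ball (0 : ℂ) (θ * t) ∩ {z | ε ≤ f z}) := measure_mono hsub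
    _ = ε⁻¹ * (ε * volume (ball (0 : ℂ) (θ * t) ∩ {z | ε ≤ f z})) := by
        rw [← mul_assoc, ENNReal.inv_mul_cancel hε0 hεtop, one_mul]
    _ ≤ ε⁻¹ * ∫⁻ z in ball (0 : ℂ) (θ * t), f z := mul_le_mul_of_nonneg_left hmarkov bot_le
    _ = ENNReal.ofReal (4 / (γ ^ 2 * t ^ 2)) * ∫⁻ z in ball (0 : ℂ) (θ * t), f z := by rw [hinv]

/-- BAND ENERGY on the chart disc `‖z‖ < θt`:
`∫_{band} ‖F_t'‖ₑ² ≤ (2/(1−θ²))·∫‖V∘Φ_t‖ₑ² + (2t²/(1−θ²))·∫‖DV∘Φ_t‖ₑ²`. [folklore] -/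
theorem lintegral_band_chartFluxDeriv_le (hon : Orthonormal ℝ ![e, e₁, e₂]) (hV : ContDiff ℝ 1 V) {t θ : ℝ}
    (ht : 0 < t) (hθ0 : 0 ≤ θ) (hθ1 : θ < 1) (a b : ℝ) :
    ∫⁻ z in bandSet (chartFlux e e₁ e₂ V t) (θ * t) a b, ‖chartFluxDeriv e e₁ e₂ V t z‖ₑ ^ 2 ≤
      ENNReal.ofReal (2 / (1 - θ ^ 2)) * (∫⁻ z in ball (0 : ℂ) (θ * t), ‖V (sphereChart e e₁ e₂ t z)‖ₑ ^ 2) +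
        ENNReal.ofReal (2 * t ^ 2 / (1 - θ ^ 2)) *
          (∫⁻ z in ball (0 : ℂ) (θ * t), ‖fderiv ℝ V (sphereChart e e₁ e₂ t z)‖ₑ ^ 2) := by
  have hφ := continuous_sphereChart e e₁ e₂ t
  have hmA : Measurable fun z : ℂ => ‖V (sphereChart e e₁ e₂ t z)‖ₑ ^ 2 :=
    ((hV.continuous.comp hφ).measurable.enorm).pow_const 2
  have hmE : Measurable fun z : ℂ => ‖fderiv ℝ V (sphereChart e e₁ e₂ t z)‖ₑ ^ 2 :=
    (((hV.continuous_fderiv one_ne_zero).comp hφ).measurable.enorm).pow_const 2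
  have hsub : bandSet (chartFlux e e₁ e₂ V t) (θ * t) a b ⊆ ball (0 : ℂ) (θ * t) := fun z hz =>
    mem_ball_zero_iff.2 hz.1
  calc ∫⁻ z in bandSet (chartFlux e e₁ e₂ V t) (θ * t) a b, ‖chartFluxDeriv e e₁ e₂ V t z‖ₑ ^ 2
      ≤ ∫⁻ z in ball (0 : ℂ) (θ * t), ‖chartFluxDeriv e e₁ e₂ V t z‖ₑ ^ 2 := lintegral_mono_set hsub
    _ ≤ ∫⁻ z in ball (0 : ℂ) (θ * t), (ENNReal.ofReal (2 / (1 - θ ^ 2)) * ‖V (sphereChart e e₁ e₂ t z)‖ₑ ^ 2 +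
          ENNReal.ofReal (2 * t ^ 2 / (1 - θ ^ 2)) * ‖fderiv ℝ V (sphereChart e e₁ e₂ t z)‖ₑ ^ 2) := by
        refine setLIntegral_mono' measurableSet_ball fun z hz => ?_
        exact enorm_chartFluxDeriv_sq_le hon ht hθ0 hθ1 (mem_ball_zero_iff.1 hz).le
    _ = ENNReal.ofReal (2 / (1 - θ ^ 2)) * (∫⁻ z in ball (0 : ℂ) (θ * t), ‖V (sphereChart e e₁ e₂ t z)‖ₑ ^ 2) +
          ENNReal.ofReal (2 * t ^ 2 / (1 - θ ^ 2)) *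
            (∫⁻ z in ball (0 : ℂ) (θ * t), ‖fderiv ℝ V (sphereChart e e₁ e₂ t z)‖ₑ ^ 2) := by
        rw [lintegral_add_left (hmA.const_mul _), lintegral_const_mul _ hmA, lintegral_const_mul _ hmE]

/-- **THE FAST SET ON ONE CHART IS SUPER-EXPONENTIALLY SMALL.**  With chart energies `𝒜, ℰ` on `‖z‖ < 9t/10` and any
`J ≥ 1` admissible for the band law (`bandConst·J²·A₀ ≤ (t/20)²/8`, `8·bandConst·J·E ≤ (γt²/2)²` with
`A₀ = 4𝒜/(γ²t²)`, `E = (200/19)(𝒜 + t²ℰ)`): `|{‖z‖ < 17t/20 : F_t(z) > γt²}| ≤ A₀·e^{−J/4}`.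
[ROUND-38 §1 (K′) per sphere; folklore given the band law] -/
theorem chart_fastArea_le (hon : Orthonormal ℝ ![e, e₁, e₂]) (hV : ContDiff ℝ 1 V) {t γ 𝒜 ℰ : ℝ} (ht : 0 < t)
    (hγ : 0 < γ) (h𝒜 : 0 ≤ 𝒜) (hℰ : 0 ≤ ℰ)
    (hA : ∫⁻ z in ball (0 : ℂ) (9 / 10 * t), ‖V (sphereChart e e₁ e₂ t z)‖ₑ ^ 2 ≤ ENNReal.ofReal 𝒜)
    (hE : ∫⁻ z in ball (0 : ℂ) (9 / 10 * t), ‖fderiv ℝ V (sphereChart e e₁ e₂ t z)‖ₑ ^ 2 ≤ ENNReal.ofReal ℰ)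
    {J : ℕ} (hJ : 0 < J) (hJA : bandConst * (J : ℝ) ^ 2 * (4 * 𝒜 / (γ ^ 2 * t ^ 2)) ≤ (t / 20) ^ 2 / 8)
    (hJE : 8 * bandConst * (J : ℝ) * (200 / 19 * (𝒜 + t ^ 2 * ℰ)) ≤ (γ * t ^ 2 / 2) ^ 2) :
    (volume (levSet (chartFlux e e₁ e₂ V t) (17 / 20 * t) (γ * t ^ 2))).toReal ≤
      4 * 𝒜 / (γ ^ 2 * t ^ 2) * Real.exp (-(J : ℝ) / 4) := by
  have hFc := continuous_chartFlux (e := e) (e₁ := e₁) (e₂ := e₂) hV.continuous t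
  have hF : ∀ z ∈ ball (0 : ℂ) t, HasFDerivAt (chartFlux e e₁ e₂ V t) (chartFluxDeriv e e₁ e₂ V t z) z :=
    fun z hz => hasFDerivAt_chartFlux hV (mem_ball_zero_iff.1 hz)
  have hF'c := continuousOn_chartFluxDeriv (e := e) (e₁ := e₁) (e₂ := e₂) hV t
  have h1 : (0 : ℝ) < 17 / 20 * t := by positivity
  have h12 : 17 / 20 * t < 9 / 10 * t := by linarith
  have h2r : 9 / 10 * t < t := by linarith
  have hab : γ * t ^ 2 / 2 < γ * t ^ 2 := by have := mul_pos hγ (pow_pos ht 2); linarith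
  have hA₀ : 0 ≤ 4 * 𝒜 / (γ ^ 2 * t ^ 2) := by positivity
  have hE₀ : 0 ≤ 200 / 19 * (𝒜 + t ^ 2 * ℰ) := by positivity
  -- A₀
  have hA' : volume (levSet (chartFlux e e₁ e₂ V t) (9 / 10 * t) (γ * t ^ 2 / 2)) ≤
      ENNReal.ofReal (4 * 𝒜 / (γ ^ 2 * t ^ 2)) := by
    refine (volume_levSet_half_le hon hV.continuous ht (by norm_num) hγ).trans ?_
    rw [show 4 * 𝒜 / (γ ^ 2 * t ^ 2) = 4 / (γ ^ 2 * t ^ 2) * 𝒜 by ring, ENNReal.ofReal_mul (by positivity)]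
    exact mul_le_mul_of_nonneg_left hA bot_le
  -- E
  have hE' : ∫⁻ z in bandSet (chartFlux e e₁ e₂ V t) (9 / 10 * t) (γ * t ^ 2 / 2) (γ * t ^ 2),
      ‖chartFluxDeriv e e₁ e₂ V t z‖ₑ ^ 2 ≤ ENNReal.ofReal (200 / 19 * (𝒜 + t ^ 2 * ℰ)) := by
    refine (lintegral_band_chartFluxDeriv_le hon hV ht (by norm_num) (by norm_num) _ _).trans ?_
    have hc1 : (2 : ℝ) / (1 - (9 / 10) ^ 2) = 200 / 19 := by norm_num
    have hc2 : (2 : ℝ) * t ^ 2 / (1 - (9 / 10) ^ 2) = 200 / 19 * t ^ 2 := by ring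
    have hsplit : ENNReal.ofReal (200 / 19 * (𝒜 + t ^ 2 * ℰ)) =
        ENNReal.ofReal (200 / 19) * ENNReal.ofReal 𝒜 + ENNReal.ofReal (200 / 19 * t ^ 2) * ENNReal.ofReal ℰ := by
      rw [← ENNReal.ofReal_mul (by norm_num), ← ENNReal.ofReal_mul (by positivity),
        ← ENNReal.ofReal_add (by positivity) (by positivity)]
      congr 1
      ring
    rw [hc1, hc2, hsplit]
    exact add_le_add (mul_le_mul_of_nonneg_left hA bot_le) (mul_le_mul_of_nonneg_left hE bot_le)
  have hband := band_decay hFc hF hF'c h1 h12 h2r hab hA₀ hE₀ hA' hE' hJ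
    (by rw [show 9 / 10 * t - 17 / 20 * t = t / 20 by ring]; exact hJA)
    (by rw [show γ * t ^ 2 - γ * t ^ 2 / 2 = γ * t ^ 2 / 2 by ring]; exact hJE)
  exact hband

end Summit.NavierStokesRegularity.NavierStokesRegularity.Theorems.PowerGaugeEulerLiouville.NeedleChartFastArea
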